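import Literature.NumberTheory.Rogawski1990.TamagawaSingularMembersLetter          -- ★ p833072: the S1′ letter `TamagawaSingularMembersExist` — the κ-block vocabulary
import HarnessLib

/-!
# κ-BLOCK TRANSPORT ALONG A CONSTANT ARCHIMEDEAN RATIO: the local κ-letters (κ-loc)(κ-arch)(κ-sign) of the singular members are invariant under replacing the
# archimedean member by a constant positive multiple on the singular stable classes (Rogawski 1990 §8.2 Prop. 8.2.1; §14.5 Lemma 14.5.2 (b) p. 238)

Topic `NumberTheory/Rogawski1990`; namespace `Literature.NumberTheory.Rogawski1990`.  THEOREMS ONLY (no `def`, no instance, no notation, no axiom, no named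
fact, no `sorry`).  Cell `pub/hodgecm-mathlib`, ENGINE T1 (crux H413 = `stmt-HodgeConjecture-24833`); the `stub_S1` (S1′ = books #88) road, brick (W6′) — the sibling
of ★ `TamagawaSingularCovolumeTransport` ((W6), the (K7-s) transport) for the κ-BLOCK of ★ `TamagawaSingularMembersExist` (F0P3a-p07 (g10)).  Count-neutral;
HONEST LABEL: HC_CM is proved only modulo the printed citations until rung 0 closes.

WHAT.  The κ-block of S1′ («at a non-central split-singular `γ₀` with partner `γ_H = (e₁•1₂, e₂)` there are local κ-constants `c_v ≠ 0`, `c_∞ ≠ 0` with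
(κ-loc) ∧ (κ-arch) ∧ (κ-sign)», [Rogawski1990 Prop. 8.2.1 (a)(b) pp. 117–118; L. 14.5.2 (b) p. 238]) reads the archimedean member `mGis` ONLY in (κ-arch), through
the unsigned archimedean stable-class sum `archStableOrbitalIntegral L 3 H′ mGis a (γ₀ ⊗ 1)` — a `finsum` of class orbital integrals, LINEAR in the member
measure class by class (§1).  Hence (§2): if `m₁ c = K • m₂ c` (`K : ℝ≥0`, `K ≠ 0`) at every archimedean class `c` stably conjugate to `γ₀ ⊗ 1` for a
non-regular non-central rational `γ₀` — the CLASS-LEVEL shape of the (W-a) export of the (ST-∞) witness road («the built singular member is `K •` the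
differential-top-form member»; both are ★ `IsQuotientOf` families, so the proportionality of their torus data is a proportionality of MEMBERS) — then the
VERBATIM κ-block for `(mGs, m₁)` follows from the VERBATIM κ-block for `(mGs, m₂)`: same `c_v`, `c_∞ ↦ K·c_∞` ((κ-arch) rescales, (κ-loc) does not read the
archimedean member, (κ-sign)'s positive real `r ↦ K·r`).  Everything is Mathlib + ★; no new definition.

* §1 `classOrbitalIntegral_eq_mul_of_eq_smul`, `stableOrbitalIntegralRel_eq_mul_of_eq_smul` — linearity of (stable) class orbital integrals in the member (generic group).
* §2 `not_isRegularElt_of_charpoly_eq_sq_mul` (the κ-block's eigenvalue binder ⇒ non-regular), **`tamagawaSingularKappaBlock_transport_of_eq_smul`** — the transport.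

## References
* [Rogawski1990] J. D. Rogawski, *Automorphic Representations of Unitary Groups in Three Variables*, Ann. of Math. Stud. 123 (1990), §4.1 (4.1.1)–(4.1.2) pp. 39–40;
  §8.2 Prop. 8.2.1 (a), (b) pp. 117–118; §14.5 Lemma 14.5.2 (b) pp. 238–239.
* [Gelbart1975] S. Gelbart, *Automorphic forms on adele groups* (1975), (9.13).
-/

set_option autoImplicit false

noncomputable section

open MeasureTheory Measure NumberField IsDedekindDomain
open Literature.MeasureTheory.Group Literature.NumberTheory.Automorphic
open Literature.AlgebraicGeometry.ShimuraVarieties (unitaryGroup hermForm)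
open scoped Matrix MatrixGroups NNReal ENNReal

namespace Literature.NumberTheory.Rogawski1990

/-! ## §1 Linearity of (stable) class orbital integrals in the member -/

section Linear

variable {G : Type*} [Group G] [∀ γ : G, MeasurableSpace (G ⧸ Subgroup.centralizer ({γ} : Set G))]

/-- `(K • μ : Measure) = (K : ℝ≥0∞) • μ` (bookkeeping between the two scalar actions). [folklore] -/
private theorem nnreal_smul_measure_eq_coe_smul {α : Type*} [MeasurableSpace α] (K : ℝ≥0) (μ : Measure α) :
    (K • μ : Measure α) = (K : ℝ≥0∞) • μ := by
  ext s _
  rw [Measure.smul_apply, Measure.smul_apply, ENNReal.smul_def]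

/-- **Class orbital integrals are linear in the member**: `m₁ c = K • m₂ c ⇒ Φ_{m₁}(c, f) = K · Φ_{m₂}(c, f)` (★ `orbitalIntegral_smul_measure`).
[cite: Rogawski1990, §4.1 (4.1.1) p. 39] -/
theorem classOrbitalIntegral_eq_mul_of_eq_smul (m₁ m₂ : OrbitalMeasureFamily G) (c : ConjClasses G) (K : ℝ≥0) (h : m₁ c = K • m₂ c) (f : G → ℂ) :
    classOrbitalIntegral m₁ f c = (K : ℂ) * classOrbitalIntegral m₂ f c := by
  rw [classOrbitalIntegral_eq, classOrbitalIntegral_eq, h, nnreal_smul_measure_eq_coe_smul, orbitalIntegral_smul_measure, ENNReal.coe_toReal,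
    Complex.real_smul]

/-- **Stable class sums are linear in the member on the stable class**: if `m₁ c = K • m₂ c` at every class `c` with `st γ (out c)`, then
`Φ^{st}_{m₁}(γ, f) = K · Φ^{st}_{m₂}(γ, f)` (`finsum` over the same index set; ★ `mul_finsum_mem`, no finiteness needed). [cite: Rogawski1990, §4.1 (4.1.1) p. 39] -/
theorem stableOrbitalIntegralRel_eq_mul_of_eq_smul (st : G → G → Prop) (m₁ m₂ : OrbitalMeasureFamily G) (γ : G) (K : ℝ≥0) (f : G → ℂ)
    (h : ∀ c : ConjClasses G, st γ (Quotient.out c) → m₁ c = K • m₂ c) :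
    stableOrbitalIntegralRel st m₁ f γ = (K : ℂ) * stableOrbitalIntegralRel st m₂ f γ := by
  rw [stableOrbitalIntegralRel_def, stableOrbitalIntegralRel_def, mul_finsum_mem]
  exact finsum_mem_congr rfl fun c hc => classOrbitalIntegral_eq_mul_of_eq_smul m₁ m₂ c K (h c hc) f

end Linear

/-! ## §2 The κ-block transport -/

section NonRegular

/-- The κ-block's eigenvalue binder makes `γ₀` NON-REGULAR: a characteristic polynomial `(X − e₁)² (X − e₂)` is not separable (★ `Polynomial.Separable.of_pow`).
[cite: Rogawski1990, §3.1 p. 19] -/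
theorem not_isRegularElt_of_charpoly_eq_sq_mul {R : Type*} [Field R] (g : GL (Fin 3) R) (e₁ e₂ : R)
    (hchar : (g : Matrix (Fin 3) (Fin 3) R).charpoly = (Polynomial.X - Polynomial.C e₁) ^ 2 * (Polynomial.X - Polynomial.C e₂)) :
    ¬ IsRegularElt g := by
  intro hreg
  rw [isRegularElt_iff, hchar] at hreg
  have h2 := (Polynomial.Separable.of_pow (Polynomial.not_isUnit_X_sub_C e₁) two_ne_zero hreg.of_mul_left).2
  exact absurd h2 (by norm_num)

end NonRegular

section Transport

variable (L : Type) [Field L] [NumberField L] [IsCMField L]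

variable (H' : Matrix (Fin 3) (Fin 3) L) (Tinf : ArchTransferFactor L H')
    [∀ γ : UnitaryGroup.arch (↥(maximalRealSubfield L)) L (IsCMField.complexConj L) 3 H',
      MeasurableSpace (UnitaryGroup.arch (↥(maximalRealSubfield L)) L (IsCMField.complexConj L) 3 H' ⧸ Subgroup.centralizer ({γ} : Set (UnitaryGroup.arch (↥(maximalRealSubfield L)) L (IsCMField.complexConj L) 3 H')))]
    [∀ (v : HeightOneSpectrum (𝓞 ↥(maximalRealSubfield L))) (γ : (UnitaryGroup.cmDatum L 3 H').Local v),
      MeasurableSpace ((UnitaryGroup.cmDatum L 3 H').Local v ⧸ Subgroup.centralizer ({γ} : Set ((UnitaryGroup.cmDatum L 3 H').Local v)))]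
    [∀ (v : HeightOneSpectrum (𝓞 ↥(maximalRealSubfield L))) (a : ((UnitaryGroup.cmDatum L 2 (Matrix.of fun i j : Fin 2 => if i.val + j.val + 1 = 2 then (1 : L) else 0)).Local v ×
        (UnitaryGroup.cmDatum L 1 (Matrix.of fun i j : Fin 1 => if i.val + j.val + 1 = 1 then (1 : L) else 0)).Local v)),
      MeasurableSpace (((UnitaryGroup.cmDatum L 2 (Matrix.of fun i j : Fin 2 => if i.val + j.val + 1 = 2 then (1 : L) else 0)).Local v ×
        (UnitaryGroup.cmDatum L 1 (Matrix.of fun i j : Fin 1 => if i.val + j.val + 1 = 1 then (1 : L) else 0)).Local v) ⧸ Subgroup.centralizer ({a} : Set ((UnitaryGroup.cmDatum L 2 (Matrix.of fun i j : Fin 2 => if i.val + j.val + 1 = 2 then (1 : L) else 0)).Local v ×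
        (UnitaryGroup.cmDatum L 1 (Matrix.of fun i j : Fin 1 => if i.val + j.val + 1 = 1 then (1 : L) else 0)).Local v)))]
    [∀ a : (UnitaryGroup.arch (↥(maximalRealSubfield L)) L (IsCMField.complexConj L) 2 (Matrix.of fun i j : Fin 2 => if i.val + j.val + 1 = 2 then (1 : L) else 0) ×
          UnitaryGroup.arch (↥(maximalRealSubfield L)) L (IsCMField.complexConj L) 1 (Matrix.of fun i j : Fin 1 => if i.val + j.val + 1 = 1 then (1 : L) else 0)),
      MeasurableSpace ((UnitaryGroup.arch (↥(maximalRealSubfield L)) L (IsCMField.complexConj L) 2 (Matrix.of fun i j : Fin 2 => if i.val + j.val + 1 = 2 then (1 : L) else 0) ×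
          UnitaryGroup.arch (↥(maximalRealSubfield L)) L (IsCMField.complexConj L) 1 (Matrix.of fun i j : Fin 1 => if i.val + j.val + 1 = 1 then (1 : L) else 0)) ⧸ Subgroup.centralizer ({a} : Set (UnitaryGroup.arch (↥(maximalRealSubfield L)) L (IsCMField.complexConj L) 2 (Matrix.of fun i j : Fin 2 => if i.val + j.val + 1 = 2 then (1 : L) else 0) ×
          UnitaryGroup.arch (↥(maximalRealSubfield L)) L (IsCMField.complexConj L) 1 (Matrix.of fun i j : Fin 1 => if i.val + j.val + 1 = 1 then (1 : L) else 0))))]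

/-- **κ-BLOCK TRANSPORT ALONG A CONSTANT ARCHIMEDEAN RATIO.**  Let `mGs` be finite local class-indexed orbital families of `U(H′)`, `m₁, m₂` two archimedean ones
and `K ≠ 0` in `ℝ≥0` with `m₁ c = K • m₂ c` at every archimedean class `c` whose representative is stably conjugate (`Corresponds … H′ H′`, = `IsStablyConj`) to
`γ₀ ⊗ 1` for some non-regular NON-CENTRAL rational `γ₀` (hypothesis `hK`, the class-level (W-a) shape).  IF the κ-block of ★ `TamagawaSingularMembersExist` holds for
`(mGs, m₂)` (hypothesis `hTF`, the letter's text with `mGis := m₂`) THEN it holds VERBATIM for `(mGs, m₁)`: at `(γ₀; e₁, e₂; γ_H)` take the same finite constants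
`c_v` and `c_∞ ↦ K · c_∞`; (κ-loc) is untouched (it reads `mGs` only), (κ-arch) rescales by §1 (`archStableOrbitalIntegral` is the stable class sum for
`IsStablyConj (c ⊗ 1) (H′ ⊗ 1)`; the eigenvalue binder gives non-regularity, `not_isRegularElt_of_charpoly_eq_sq_mul`), and (κ-sign)'s positive real becomes
`K · r > 0`.  This is the junction «κ-block for the BUILT (ST-∞) witness ⟸ κ-block for the differential-top-form member under it» of the `stub_S1` road; print's
constants [Rogawski1990 Prop. 8.2.1 (a): `Δ_{G∕H}(γ₀)Φ^κ(γ₀, f) = f^H(γ₀)` at every place; (b): `ΠΔ_{G_v∕H_v}(γ_{0v}) = 1`] are for compatible measures, and a common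
positive rescaling of the archimedean members of one stable class multiplies `c_∞` by that factor and nothing else.
[cite: Rogawski1990, §8.2 Prop. 8.2.1 (a), (b) pp. 117–118; §14.5 Lemma 14.5.2 (b) p. 238] -/
theorem tamagawaSingularKappaBlock_transport_of_eq_smul
    (Δ : ∀ v : HeightOneSpectrum (𝓞 ↥(maximalRealSubfield L)), LocalTransferFactor L H' v)
      (mH : ∀ v : HeightOneSpectrum (𝓞 ↥(maximalRealSubfield L)),
        OrbitalMeasureFamily ((UnitaryGroup.cmDatum L 2 (Matrix.of fun i j : Fin 2 => if i.val + j.val + 1 = 2 then (1 : L) else 0)).Local v ×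
          (UnitaryGroup.cmDatum L 1 (Matrix.of fun i j : Fin 1 => if i.val + j.val + 1 = 1 then (1 : L) else 0)).Local v))
      (mG : ∀ v : HeightOneSpectrum (𝓞 ↥(maximalRealSubfield L)), OrbitalMeasureFamily ((UnitaryGroup.cmDatum L 3 H').Local v))
    (m' : OrbitalMeasureFamily (UnitaryGroup.arch (↥(maximalRealSubfield L)) L (IsCMField.complexConj L) 3 H'))
    (mHi : OrbitalMeasureFamily (UnitaryGroup.arch (↥(maximalRealSubfield L)) L (IsCMField.complexConj L) 2
            (Matrix.of fun i j : Fin 2 => if i.val + j.val + 1 = 2 then (1 : L) else 0) ×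
          UnitaryGroup.arch (↥(maximalRealSubfield L)) L (IsCMField.complexConj L) 1
            (Matrix.of fun i j : Fin 1 => if i.val + j.val + 1 = 1 then (1 : L) else 0)))
    (mGs : ∀ v : HeightOneSpectrum (𝓞 ↥(maximalRealSubfield L)), OrbitalMeasureFamily ((UnitaryGroup.cmDatum L 3 H').Local v))
    (m₁ m₂ : OrbitalMeasureFamily (UnitaryGroup.arch (↥(maximalRealSubfield L)) L (IsCMField.complexConj L) 3 H'))
    (K : ℝ≥0) (hK0 : K ≠ 0)
    (hK : ∀ c : ConjClasses (UnitaryGroup.arch (↥(maximalRealSubfield L)) L (IsCMField.complexConj L) 3 H'),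
      (∃ γ₀ : (UnitaryGroup.cmDatum L 3 H').Rational, ¬ IsRegularElt (γ₀.val : GL (Fin 3) L) ∧
        (¬ ∃ ζ : L, ((γ₀.val : GL (Fin 3) L) : Matrix (Fin 3) (Fin 3) L) = ζ • (1 : Matrix (Fin 3) (Fin 3) L)) ∧
        Corresponds (UnitaryGroup.conjMixed (↥(maximalRealSubfield L)) L (IsCMField.complexConj L)) (UnitaryGroup.archFormOf L 3 H')
          (UnitaryGroup.archFormOf L 3 H') (cmRationalToArch L 3 H' γ₀) (Quotient.out c)) →
      m₁ c = K • m₂ c)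
    (hTF :
      -- κ-BLOCK of ★ `TamagawaSingularMembersExist` with `mGis := m₂`
      (∀ (γ₀ : (UnitaryGroup.cmDatum L 3 H').Rational) (e₁ e₂ : L), e₁ ≠ e₂ →
        ((((γ₀ : unitaryGroup (cmConjRingHom L) H').val : GL (Fin 3) L) : Matrix (Fin 3) (Fin 3) L) - e₁ • (1 : Matrix (Fin 3) (Fin 3) L)) * ((((γ₀ : unitaryGroup (cmConjRingHom L) H').val : GL (Fin 3) L) : Matrix (Fin 3) (Fin 3) L) - e₂ • (1 : Matrix (Fin 3) (Fin 3) L)) = 0 →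
        (¬ ∃ ζ : L, (((γ₀ : unitaryGroup (cmConjRingHom L) H').val : GL (Fin 3) L) : Matrix (Fin 3) (Fin 3) L) = ζ • (1 : Matrix (Fin 3) (Fin 3) L)) →
        -- `e₁` is the DOUBLE eigenvalue (ref1 R1-165 O1: the partner `γH = (e₁•1₂, e₂)` below is print's `γ_H` with `A_{G∕H}(γ_H) = 𝒪_st(γ₀)` only then)
        (((γ₀ : unitaryGroup (cmConjRingHom L) H').val : GL (Fin 3) L) : Matrix (Fin 3) (Fin 3) L).charpoly =
          (Polynomial.X - Polynomial.C e₁) ^ 2 * (Polynomial.X - Polynomial.C e₂) →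
        ∀ (γH : (UnitaryGroup.cmDatum L 2 (Matrix.of fun i j : Fin 2 => if i.val + j.val + 1 = 2 then (1 : L) else 0)).Rational ×
            (UnitaryGroup.cmDatum L 1 (Matrix.of fun i j : Fin 1 => if i.val + j.val + 1 = 1 then (1 : L) else 0)).Rational),
          (((γH.1 : unitaryGroup (cmConjRingHom L) (Matrix.of fun i j : Fin 2 => if i.val + j.val + 1 = 2 then (1 : L) else 0)).val : GL (Fin 2) L) : Matrix (Fin 2) (Fin 2) L) =
            e₁ • (1 : Matrix (Fin 2) (Fin 2) L) →
          (((γH.2 : unitaryGroup (cmConjRingHom L) (Matrix.of fun i j : Fin 1 => if i.val + j.val + 1 = 1 then (1 : L) else 0)).val : GL (Fin 1) L) : Matrix (Fin 1) (Fin 1) L) 0 0 = e₂ →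
          ∃ (c : HeightOneSpectrum (𝓞 ↥(maximalRealSubfield L)) → ℂ) (cinf : ℂ), (∀ v, c v ≠ 0) ∧ cinf ≠ 0 ∧
            -- (κ-loc) [Prop. 8.2.1 (a) p. 117; §4.9 p. 54]: the member's UNSIGNED local stable-class sum at `γ₀` (= print's `Φ^κ(γ₀, ·)` of (4.1.2), n239-1) on a `Δ_v`-matching pair is `c_v · f_v^H(γ_H)`, `c_v ≠ 0`
            (∀ (v : HeightOneSpectrum (𝓞 ↥(maximalRealSubfield L)))
                  (fH : (UnitaryGroup.cmDatum L 2 (Matrix.of fun i j : Fin 2 => if i.val + j.val + 1 = 2 then (1 : L) else 0)).Local v × (UnitaryGroup.cmDatum L 1 (Matrix.of fun i j : Fin 1 => if i.val + j.val + 1 = 1 then (1 : L) else 0)).Local v → ℂ) (f : (UnitaryGroup.cmDatum L 3 H').Local v → ℂ),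
                IsLocSmooth f → IsLocSmooth fH → IsLocalDeltaTransfer L H' v (Δ v) (mH v) (mG v) fH f →
                localStableOrbitalIntegral L 3 H' v (mGs v) f ((UnitaryGroup.cmDatum L 3 H').toLocal v ((UnitaryGroup.cmDatum L 3 H').toAdelic γ₀)) =
                  c v * fH ((UnitaryGroup.cmDatum L 2 (Matrix.of fun i j : Fin 2 => if i.val + j.val + 1 = 2 then (1 : L) else 0)).toLocal v ((UnitaryGroup.cmDatum L 2 (Matrix.of fun i j : Fin 2 => if i.val + j.val + 1 = 2 then (1 : L) else 0)).toAdelic γH.1),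
                    (UnitaryGroup.cmDatum L 1 (Matrix.of fun i j : Fin 1 => if i.val + j.val + 1 = 1 then (1 : L) else 0)).toLocal v ((UnitaryGroup.cmDatum L 1 (Matrix.of fun i j : Fin 1 => if i.val + j.val + 1 = 1 then (1 : L) else 0)).toAdelic γH.2))) ∧
            -- (κ-arch) [Prop. 8.2.1 (a), ℂ∕ℝ case pp. 117–118 (indefinite place); L. 14.5.2 (b) proof p. 238 (compact places `v ∈ S₀`); §4.9]: the same on `G′_∞ = ∏_{v∣∞} G′_v` as ONE real group
            -- («the method of 8.2.1», inside ★ :301's honest bracket): the UNSIGNED archimedean stable-class sum at `γ₀` is `c_∞ · a^H(γ_H)`, `c_∞ = ∏_{v∣∞} Δ_{G_v∕H_v}(γ₀)⁻¹ ≠ 0`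
            (∀ (aH : UnitaryGroup.arch (↥(maximalRealSubfield L)) L (IsCMField.complexConj L) 2 (Matrix.of fun i j : Fin 2 => if i.val + j.val + 1 = 2 then (1 : L) else 0) ×
                    UnitaryGroup.arch (↥(maximalRealSubfield L)) L (IsCMField.complexConj L) 1 (Matrix.of fun i j : Fin 1 => if i.val + j.val + 1 = 1 then (1 : L) else 0) → ℂ)
                  (a : UnitaryGroup.arch (↥(maximalRealSubfield L)) L (IsCMField.complexConj L) 3 H' → ℂ),
                ArchSmooth L 3 H' a → ArchSmooth₂ L aH → IsArchDeltaTransfer L H' Tinf mHi m' aH a →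
                archStableOrbitalIntegral L 3 H' m₂ a (cmRationalToArch L 3 H' γ₀) =
                  cinf * aH (cmRationalToArch L 2 (Matrix.of fun i j : Fin 2 => if i.val + j.val + 1 = 2 then (1 : L) else 0) γH.1, cmRationalToArch L 1 (Matrix.of fun i j : Fin 1 => if i.val + j.val + 1 = 1 then (1 : L) else 0) γH.2)) ∧
            -- (κ-sign) [Prop. 8.2.1 (b) proof p. 117 «`ΠΔ_{G_v∕H_v}(γ_{0v}) = 1` for `γ₀ ∈ M`» ALONE = the product formula (the line's `hCTM` carries it at the `G`-REGULAR pairs as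
            -- `SatisfiesProductFormula L H' Δ Tinf.Δ`, pinning the canonical datum's global normalisation; at the (G,H)-regular singular `γ₀` it is print's, inside ★ :301's honest bracket);
            -- L. 14.5.2 (b) p. 239]: the product of the κ-constants over any co-unit set is a POSITIVE real (print: `= 1`; the co-unit set itself is P4's business, not the letter's)
            (∀ S_c : Finset (HeightOneSpectrum (𝓞 ↥(maximalRealSubfield L))), (∀ v ∉ S_c, c v = 1) →
                ∃ r : ℝ, 0 < r ∧ cinf * ∏ v ∈ S_c, c v = (r : ℂ)))) :
    -- κ-BLOCK of ★ `TamagawaSingularMembersExist` VERBATIM (`mGis := m₁`)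
    (∀ (γ₀ : (UnitaryGroup.cmDatum L 3 H').Rational) (e₁ e₂ : L), e₁ ≠ e₂ →
        ((((γ₀ : unitaryGroup (cmConjRingHom L) H').val : GL (Fin 3) L) : Matrix (Fin 3) (Fin 3) L) - e₁ • (1 : Matrix (Fin 3) (Fin 3) L)) * ((((γ₀ : unitaryGroup (cmConjRingHom L) H').val : GL (Fin 3) L) : Matrix (Fin 3) (Fin 3) L) - e₂ • (1 : Matrix (Fin 3) (Fin 3) L)) = 0 →
        (¬ ∃ ζ : L, (((γ₀ : unitaryGroup (cmConjRingHom L) H').val : GL (Fin 3) L) : Matrix (Fin 3) (Fin 3) L) = ζ • (1 : Matrix (Fin 3) (Fin 3) L)) →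
        -- `e₁` is the DOUBLE eigenvalue (ref1 R1-165 O1: the partner `γH = (e₁•1₂, e₂)` below is print's `γ_H` with `A_{G∕H}(γ_H) = 𝒪_st(γ₀)` only then)
        (((γ₀ : unitaryGroup (cmConjRingHom L) H').val : GL (Fin 3) L) : Matrix (Fin 3) (Fin 3) L).charpoly =
          (Polynomial.X - Polynomial.C e₁) ^ 2 * (Polynomial.X - Polynomial.C e₂) →
        ∀ (γH : (UnitaryGroup.cmDatum L 2 (Matrix.of fun i j : Fin 2 => if i.val + j.val + 1 = 2 then (1 : L) else 0)).Rational ×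
            (UnitaryGroup.cmDatum L 1 (Matrix.of fun i j : Fin 1 => if i.val + j.val + 1 = 1 then (1 : L) else 0)).Rational),
          (((γH.1 : unitaryGroup (cmConjRingHom L) (Matrix.of fun i j : Fin 2 => if i.val + j.val + 1 = 2 then (1 : L) else 0)).val : GL (Fin 2) L) : Matrix (Fin 2) (Fin 2) L) =
            e₁ • (1 : Matrix (Fin 2) (Fin 2) L) →
          (((γH.2 : unitaryGroup (cmConjRingHom L) (Matrix.of fun i j : Fin 1 => if i.val + j.val + 1 = 1 then (1 : L) else 0)).val : GL (Fin 1) L) : Matrix (Fin 1) (Fin 1) L) 0 0 = e₂ →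
          ∃ (c : HeightOneSpectrum (𝓞 ↥(maximalRealSubfield L)) → ℂ) (cinf : ℂ), (∀ v, c v ≠ 0) ∧ cinf ≠ 0 ∧
            -- (κ-loc) [Prop. 8.2.1 (a) p. 117; §4.9 p. 54]: the member's UNSIGNED local stable-class sum at `γ₀` (= print's `Φ^κ(γ₀, ·)` of (4.1.2), n239-1) on a `Δ_v`-matching pair is `c_v · f_v^H(γ_H)`, `c_v ≠ 0`
            (∀ (v : HeightOneSpectrum (𝓞 ↥(maximalRealSubfield L)))
                  (fH : (UnitaryGroup.cmDatum L 2 (Matrix.of fun i j : Fin 2 => if i.val + j.val + 1 = 2 then (1 : L) else 0)).Local v × (UnitaryGroup.cmDatum L 1 (Matrix.of fun i j : Fin 1 => if i.val + j.val + 1 = 1 then (1 : L) else 0)).Local v → ℂ) (f : (UnitaryGroup.cmDatum L 3 H').Local v → ℂ),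
                IsLocSmooth f → IsLocSmooth fH → IsLocalDeltaTransfer L H' v (Δ v) (mH v) (mG v) fH f →
                localStableOrbitalIntegral L 3 H' v (mGs v) f ((UnitaryGroup.cmDatum L 3 H').toLocal v ((UnitaryGroup.cmDatum L 3 H').toAdelic γ₀)) =
                  c v * fH ((UnitaryGroup.cmDatum L 2 (Matrix.of fun i j : Fin 2 => if i.val + j.val + 1 = 2 then (1 : L) else 0)).toLocal v ((UnitaryGroup.cmDatum L 2 (Matrix.of fun i j : Fin 2 => if i.val + j.val + 1 = 2 then (1 : L) else 0)).toAdelic γH.1),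
                    (UnitaryGroup.cmDatum L 1 (Matrix.of fun i j : Fin 1 => if i.val + j.val + 1 = 1 then (1 : L) else 0)).toLocal v ((UnitaryGroup.cmDatum L 1 (Matrix.of fun i j : Fin 1 => if i.val + j.val + 1 = 1 then (1 : L) else 0)).toAdelic γH.2))) ∧
            -- (κ-arch) [Prop. 8.2.1 (a), ℂ∕ℝ case pp. 117–118 (indefinite place); L. 14.5.2 (b) proof p. 238 (compact places `v ∈ S₀`); §4.9]: the same on `G′_∞ = ∏_{v∣∞} G′_v` as ONE real group
            -- («the method of 8.2.1», inside ★ :301's honest bracket): the UNSIGNED archimedean stable-class sum at `γ₀` is `c_∞ · a^H(γ_H)`, `c_∞ = ∏_{v∣∞} Δ_{G_v∕H_v}(γ₀)⁻¹ ≠ 0`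
            (∀ (aH : UnitaryGroup.arch (↥(maximalRealSubfield L)) L (IsCMField.complexConj L) 2 (Matrix.of fun i j : Fin 2 => if i.val + j.val + 1 = 2 then (1 : L) else 0) ×
                    UnitaryGroup.arch (↥(maximalRealSubfield L)) L (IsCMField.complexConj L) 1 (Matrix.of fun i j : Fin 1 => if i.val + j.val + 1 = 1 then (1 : L) else 0) → ℂ)
                  (a : UnitaryGroup.arch (↥(maximalRealSubfield L)) L (IsCMField.complexConj L) 3 H' → ℂ),
                ArchSmooth L 3 H' a → ArchSmooth₂ L aH → IsArchDeltaTransfer L H' Tinf mHi m' aH a →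
                archStableOrbitalIntegral L 3 H' m₁ a (cmRationalToArch L 3 H' γ₀) =
                  cinf * aH (cmRationalToArch L 2 (Matrix.of fun i j : Fin 2 => if i.val + j.val + 1 = 2 then (1 : L) else 0) γH.1, cmRationalToArch L 1 (Matrix.of fun i j : Fin 1 => if i.val + j.val + 1 = 1 then (1 : L) else 0) γH.2)) ∧
            -- (κ-sign) [Prop. 8.2.1 (b) proof p. 117 «`ΠΔ_{G_v∕H_v}(γ_{0v}) = 1` for `γ₀ ∈ M`» ALONE = the product formula (the line's `hCTM` carries it at the `G`-REGULAR pairs as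
            -- `SatisfiesProductFormula L H' Δ Tinf.Δ`, pinning the canonical datum's global normalisation; at the (G,H)-regular singular `γ₀` it is print's, inside ★ :301's honest bracket);
            -- L. 14.5.2 (b) p. 239]: the product of the κ-constants over any co-unit set is a POSITIVE real (print: `= 1`; the co-unit set itself is P4's business, not the letter's)
            (∀ S_c : Finset (HeightOneSpectrum (𝓞 ↥(maximalRealSubfield L))), (∀ v ∉ S_c, c v = 1) →
                ∃ r : ℝ, 0 < r ∧ cinf * ∏ v ∈ S_c, c v = (r : ℂ))) := by
  intro γ₀ e₁ e₂ hne hprod hncen hchar γH hH1 hH2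
  obtain ⟨c, cinf, hc, hcinf, hloc, harch, hsign⟩ := hTF γ₀ e₁ e₂ hne hprod hncen hchar γH hH1 hH2
  have hnreg : ¬ IsRegularElt ((γ₀ : unitaryGroup (cmConjRingHom L) H').val : GL (Fin 3) L) := not_isRegularElt_of_charpoly_eq_sq_mul _ e₁ e₂ hchar
  -- the archimedean stable-class sum at `γ₀ ⊗ 1` rescales by `K`
  have hscale : ∀ a : UnitaryGroup.arch (↥(maximalRealSubfield L)) L (IsCMField.complexConj L) 3 H' → ℂ,
      archStableOrbitalIntegral L 3 H' m₁ a (cmRationalToArch L 3 H' γ₀) = (K : ℂ) * archStableOrbitalIntegral L 3 H' m₂ a (cmRationalToArch L 3 H' γ₀) :=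
    fun a => stableOrbitalIntegralRel_eq_mul_of_eq_smul _ m₁ m₂ _ K a fun d hd => hK d ⟨γ₀, hnreg, hncen, hd⟩
  have hKpos : (0 : ℝ) < K := NNReal.coe_pos.2 (pos_iff_ne_zero.2 hK0)
  refine ⟨c, (K : ℂ) * cinf, hc, mul_ne_zero (Complex.ofReal_ne_zero.2 hKpos.ne') hcinf, hloc, ?_, ?_⟩
  · intro aH a ha haH hΔ
    rw [hscale a, harch aH a ha haH hΔ, mul_assoc]
  · intro S_c hS
    obtain ⟨r, hr, hprod'⟩ := hsign S_c hS
    refine ⟨K * r, mul_pos hKpos hr, ?_⟩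
    rw [mul_assoc, hprod', Complex.ofReal_mul]

end Transport

end Literature.NumberTheory.Rogawski1990

end
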